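import Literature.AlgebraicGeometry.Frobenioids.MotivatingExamplesSub
import Mathlib.NumberTheory.Real.Irrational
import HarnessLib

/-!
# Frobenioids I, §6 sub-DAG — discharges, part 1 (the elementary data-level rows)

Proof-only companion of `MotivatingExamplesSub.lean` (Mochizuki, *The geometry of Frobenioids I*,
Kyushu J. Math. **62** (2008), §6, kurims pp. 109–117 [cite: MochizukiFrdI2008, §6 pp.109-117]).
Discharged here (each `X_holds : X`):
* `PermScalingTrivial` (T62iii/L05a = T64i/L09 core: a permutation of the basis cannot scale a nonzero
  vector of `X →₀ ℚ` by `λ ≠ 1` — the "highest-order zero is preserved" argument, p. 112 l. 12–15);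
* `Thm64ii_L03_monotoneAddAut` (an order-preserving additive bijection of `ℝ` is `x ↦ c·x`, `c > 0`; p. 115 l. 36);
* `Thm64iii_L02_commensurability` (`ℚ_{≥0}` vs `ℝ_{≥0}`: archimedean ↔ archimedean, p. 115 l. 6–8);
* `Thm64iv_L05_degOne` (`deg · log p = log p ⟹ deg = 1`, p. 116 l. 25–27);
* `Thm64iv_L07_isoOfDegreeEq` (an embedding of number fields of equal degree is an isomorphism, p. 116 l. 33–34).
No statement of the paper is strengthened; nothing here bears on abc.
-/

noncomputable section

namespace Literature.AlgebraicGeometry.Frobenioids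

open NumberField

/-! ### T62iii/L05a: the permutation–scaling lemma -/

/-- **T62iii/L05a = T64i/L09 core** — PROVED: if a permutation `e` of the basis satisfies
`e_* D = c · D` for a nonzero `D ∈ ℚ[X]` and `c > 0`, then `c = 1` (compare the coefficient of largest
absolute value with that of its image). [cite: MochizukiFrdI2008, Thm. 6.2 (iii) p.112] -/
theorem permScalingTrivial_holds : PermScalingTrivial := by
  intro X e D c hD hc h
  -- `D x = c * D (e x)` for every `x`
  have key : ∀ x, D x = c * D (e x) := fun x => by
    have := congrArg (fun f => f (e x)) h
    simp only [Finsupp.mapDomain_apply e.injective, Finsupp.smul_apply, smul_eq_mul] at this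
    exact this
  have hne : D.support.Nonempty := Finsupp.support_nonempty_iff.mpr hD
  obtain ⟨x₀, hx₀, hmax⟩ := Finset.exists_max_image D.support (fun x => |D x|) hne
  have hx₀' : D x₀ ≠ 0 := Finsupp.mem_support_iff.mp hx₀
  have hpos : 0 < |D x₀| := abs_pos.mpr hx₀'
  -- every value is bounded by `|D x₀|` (values off the support are `0`)
  have hbound : ∀ x, |D x| ≤ |D x₀| := fun x => by
    by_cases hx : x ∈ D.support
    · exact hmax x hx
    · rw [Finsupp.notMem_support_iff.mp hx, abs_zero]; exact hpos.le
  -- `c ≥ 1`: `|D x₀| = c |D (e x₀)| ≤ c |D x₀|`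
  have h1 : |D x₀| ≤ c * |D x₀| := by
    calc |D x₀| = c * |D (e x₀)| := by rw [key x₀, abs_mul, abs_of_pos hc]
      _ ≤ c * |D x₀| := mul_le_mul_of_nonneg_left (hbound _) hc.le
  -- `c ≤ 1`: `|D (e⁻¹ x₀)| = c |D x₀| ≤ |D x₀|`
  have h2 : c * |D x₀| ≤ |D x₀| := by
    calc c * |D x₀| = |D (e.symm x₀)| := by rw [key (e.symm x₀), e.apply_symm_apply, abs_mul, abs_of_pos hc]
      _ ≤ |D x₀| := hbound _
  have hc1 : 1 ≤ c := by
    by_contra hlt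
    rw [not_le] at hlt
    have : c * |D x₀| < 1 * |D x₀| := mul_lt_mul_of_pos_right hlt hpos
    rw [one_mul] at this
    exact absurd h1 (not_le.mpr this)
  have hc2 : c ≤ 1 := by
    by_contra hlt
    rw [not_le] at hlt
    have : 1 * |D x₀| < c * |D x₀| := mul_lt_mul_of_pos_right hlt hpos
    rw [one_mul] at this
    exact absurd h2 (not_le.mpr this)
  exact le_antisymm hc2 hc1

/-! ### T64ii/L03: order-preserving additive bijections of `ℝ` -/

/-- **T64ii/L03** — PROVED: an order-preserving additive bijection `φ : ℝ → ℝ` is `x ↦ φ(1) · x` with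
`φ(1) > 0` (additivity gives `ℚ`-linearity; monotonicity and the density of `ℚ` give `ℝ`-linearity).
[cite: MochizukiFrdI2008, Thm. 6.4 (ii) p.115] -/
theorem Thm64ii_L03_monotoneAddAut_holds : Thm64ii_L03_monotoneAddAut := by
  intro φ hφ
  set c := φ 1 with hc_def
  -- `φ (q • x) = q • φ x` for rational `q`
  have hrat : ∀ (q : ℚ) (x : ℝ), φ ((q : ℝ) * x) = (q : ℝ) * φ x := fun q x => by
    have := map_rat_smul φ.toAddMonoidHom q x
    simpa [Rat.smul_def] using this
  have hc0 : 0 < c := by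
    have h01 : φ 0 ≤ φ 1 := hφ zero_le_one
    rw [map_zero] at h01
    rcases h01.lt_or_eq with h | h
    · exact h
    · exact absurd (φ.injective (by rw [map_zero]; exact h)) zero_ne_one
  refine ⟨c, hc0, fun x => ?_⟩
  -- squeeze between rationals
  apply le_antisymm
  · -- `φ x ≤ c * x`: for every rational `q > x`, `φ x ≤ φ q = q c`
    refine le_of_forall_gt_imp_ge_of_dense fun t ht => ?_
    -- choose a rational `q` with `x < q < t / c`… work with `t = c * s`
    obtain ⟨q, hxq, hqt⟩ := exists_rat_btwn ((lt_div_iff₀ hc0).mpr (by linarith [ht] : x * c < t))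
    have h1 : φ x ≤ φ q := hφ hxq.le
    have h2 : φ (q : ℝ) = (q : ℝ) * c := by
      have := hrat q 1; rw [mul_one] at this; exact this
    calc φ x ≤ (q : ℝ) * c := h2 ▸ h1
      _ ≤ t := by
        have := (lt_div_iff₀ hc0).mp hqt
        linarith
  · -- `c * x ≤ φ x`: for every rational `q < x`, `q c = φ q ≤ φ x`
    refine le_of_forall_lt_imp_le_of_dense fun t ht => ?_
    obtain ⟨q, htq, hqx⟩ := exists_rat_btwn ((div_lt_iff₀ hc0).mpr (by linarith [ht] : t < x * c))
    have h1 : φ q ≤ φ x := hφ hqx.le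
    have h2 : φ (q : ℝ) = (q : ℝ) * c := by
      have := hrat q 1; rw [mul_one] at this; exact this
    calc t ≤ (q : ℝ) * c := by
          have := (div_lt_iff₀ hc0).mp htq
          linarith
      _ ≤ φ x := h2 ▸ h1

/-! ### T64iii/L02: `ℚ_{≥0}` and `ℝ_{≥0}` are distinguished by commensurability -/

/-- **T64iii/L02, data-level core** — PROVED: any two positive rationals are commensurable; `1` and `√2`
are not. [cite: MochizukiFrdI2008, Thm. 6.4 (iii) p.115] -/
theorem Thm64iii_L02_commensurability_holds : Thm64iii_L02_commensurability := by
  refine ⟨fun x y hx hy => ?_, fun h => ?_⟩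
  · -- `r := y / x = r.num / r.den` with `r.num > 0`; take `m := r.num`, `n := r.den`
    set r : ℚ := y / x with hr
    have hr0 : 0 < r := div_pos hy hx
    have hnum : 0 < r.num := Rat.num_pos.mpr hr0
    refine ⟨r.num.toNat, r.den, by omega, r.den_pos, ?_⟩
    have hnum' : ((r.num.toNat : ℕ) : ℚ) = (r.num : ℚ) := by
      rw [← Int.cast_natCast, Int.toNat_of_nonneg hnum.le]
    rw [hnum']
    have hrx : r * x = y := by rw [hr]; field_simp
    have : (r.num : ℚ) = r * r.den := by
      rw [mul_comm]; exact (Rat.den_mul_eq_num r).symm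
    rw [this, mul_assoc, mul_comm (r.den : ℚ) x, ← mul_assoc, hrx, mul_comm]
  · -- `x = 1`, `y = √2`
    obtain ⟨m, n, hm, hn, hmn⟩ := h 1 (Real.sqrt 2) one_pos (Real.sqrt_pos.mpr two_pos)
    rw [mul_one] at hmn
    have hirr := irrational_sqrt_two
    -- `√2 = m / n`
    have : Real.sqrt 2 = (m : ℝ) / n := by
      rw [eq_div_iff (by exact_mod_cast hn.ne'), mul_comm]; exact hmn.symm
    exact hirr.ne_rat ((m : ℚ) / n) (by rw [this]; push_cast; ring)

/-! ### T64iv/L05: `deg = 1` -/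

/-- **T64iv/L05** — PROVED: at places of the same prime norm `p`, `deg · log p = log p` forces `deg = 1`.
[cite: MochizukiFrdI2008, Thm. 6.4 (iv) p.116] -/
theorem Thm64iv_L05_degOne_holds : Thm64iv_L05_degOne := by
  intro L₁ _ _ L₂ _ _ deg v₁ v₂ hp hN h
  have hlog : logNorm v₁ = logNorm v₂ := by
    simp only [logNorm, hN]
  have hne : logNorm v₂ ≠ 0 := by
    simp only [logNorm, ← hN]
    have h2 : (2 : ℝ) ≤ (Ideal.absNorm v₁.maximalIdeal.asIdeal : ℝ) := by exact_mod_cast hp.two_le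
    exact (Real.log_pos (by linarith)).ne'
  rw [hlog] at h
  have := mul_right_cancel₀ hne (h.trans (one_mul _).symm)
  exact this

/-! ### T64iv/L07: embeddings of number fields of equal degree -/

/-- **T64iv/L07** — PROVED: an embedding `L₁ →+* L₂` of number fields with `[L₁ : ℚ] = [L₂ : ℚ]` is an
isomorphism (an injective `ℚ`-linear map between spaces of equal finite dimension is bijective).
[cite: MochizukiFrdI2008, Thm. 6.4 (iv) p.116] -/
theorem Thm64iv_L07_isoOfDegreeEq_holds : Thm64iv_L07_isoOfDegreeEq := by
  intro L₁ _ _ L₂ _ _ hemb hdeg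
  obtain ⟨f⟩ := hemb
  let g : L₁ →ₐ[ℚ] L₂ := f.toRatAlgHom
  have hinj : Function.Injective g.toLinearMap := f.injective
  have hsurj : Function.Surjective g.toLinearMap :=
    (LinearMap.injective_iff_surjective_of_finrank_eq_finrank hdeg).mp hinj
  exact ⟨RingEquiv.ofBijective f ⟨f.injective, hsurj⟩⟩

end Literature.AlgebraicGeometry.Frobenioids

end
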